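import Literature.NumberTheory.LFunctions.ThetaChainFreeCheck
import HarnessLib

/-!
# Schoenfeld's `θ`-bound on `[599, 10⁸]` by kernel computation: data-free run, chunk 18 of 35

Topic: `Literature/NumberTheory/LFunctions`. Pure proof file (a kernel computation; nothing is
asserted, no definition). The theorems below evaluate `ThetaChain.runFree` — together `150000`
data-free steps of the certified `θ`-chain (`ThetaChain.stepFree`, `ThetaChainFreeCheck.lean`: the
next prime found and certified by two gcds with the primorials of the odd primes `≤ 2999` and in
`(2999, 10007]`, the enclosures of `log p` and `θ(p)`, and the two comparisons behind
`|θ(x) − x| ≤ √x log² x/(8π)`) — from the state at the prime `52560713` to the state at the prime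
`55233149`. Soundness: `ThetaChain.runFree_sound`; assembly of the 35 chunks: `ThetaUpTo1e8.lean`.
The expected states were obtained by evaluating a twin of the same function outside the kernel
(validated bit-for-bit on the tree's chunk `ThetaChainRun.xrun14`). Declarations of `5·10⁴` steps
(about `70 s` of kernel time each; the kernel's evaluation is linear within a declaration of this size),
`decide +kernel`, standard axioms only (`maxHeartbeats 0` lifts the deterministic time-out).

## References

* L. Schoenfeld, *Sharper bounds for the Chebyshev functions θ(x) and ψ(x). II*, Math. Comp. 30
  (1976), 337–360, Thm. 10 (6.3). [Schoenfeld1976]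
* J. B. Rosser, L. Schoenfeld, *Approximate formulas for some functions of prime numbers*,
  Illinois J. Math. 6 (1962), 64–94, Thms. 18–19 (`θ`-tables to `10⁸`). [RosserSchoenfeld1962]
-/

namespace Literature.NumberTheory.LFunctions.ThetaChainRun

open ThetaChain

set_option maxHeartbeats 0 in
/-- **Data-free certified `θ`-run, chunk 18a** (steps `2550001`–`2600000` after `8886113`: 50000 primes,
`52560713` to `53449667`). [cite: Schoenfeld1976, Thm. 10 (6.3)] -/
theorem frun18a :
    runFree 50000
      ⟨52560713, 21491653972194351938045963, 21491653972194827607960315, 63533645749727651968160791580196, 63533645749729148015189309631275⟩ =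
    some ⟨53449667, 21511929432646596214084163, 21511929432647071884951030, 64608736604602232840180451480949, 64608736604603752670728499307618⟩ := by
  decide +kernel

set_option maxHeartbeats 0 in
/-- **Data-free certified `θ`-run, chunk 18b** (steps `2600001`–`2650000` after `8886113`: 50000 primes,
`53449667` to `54341611`). [cite: Schoenfeld1976, Thm. 10 (6.3)] -/
theorem frun18b :
    runFree 50000
      ⟨53449667, 21511929432646596214084163, 21511929432647071884951030, 64608736604602232840180451480949, 64608736604603752670728499307618⟩ =
    some ⟨54341611, 21531936965036349012677688, 21531936965036824684496670, 65684835215091973928675809139315, 65684835215093517542791004965324⟩ := by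
  decide +kernel

set_option maxHeartbeats 0 in
/-- **Data-free certified `θ`-run, chunk 18c** (steps `2650001`–`2700000` after `8886113`: 50000 primes,
`54341611` to `55233149`). [cite: Schoenfeld1976, Thm. 10 (6.3)] -/
theorem frun18c :
    runFree 50000
      ⟨54341611, 21531936965036349012677688, 21531936965036824684496670, 65684835215091973928675809139315, 65684835215093517542791004965324⟩ =
    some ⟨55233149, 21551609873138094974019184, 21551609873138570646790321, 66761926215500193991797480793541, 66761926215501761389527433246260⟩ := by
  decide +kernel

end Literature.NumberTheory.LFunctions.ThetaChainRun
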